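import Literature.AnabelianGeometry.AbsoluteAnabelian.AbsTopII.BelyiCuspidalizationDatum
import Literature.AnabelianGeometry.AbsoluteAnabelian.AbsTopII.BelyiCuspidalizationChainUProofs

/-!
# [AbsTopII] Cor 3.7″ / Cor 3.8 of the `BelyiModel` induced by a datum model, SPELLED OUT (PROOF-ONLY)

S. Mochizuki, *Topics in Absolute Anabelian Geometry II* [AbsTopII] (bib `MochizukiAbsTopII2013`, kurims
manuscript `paper:url-585b8d0ad0d9`), §3 Cor 3.7 pp. 72–73, Cor 3.8 p. 74.

No definition, no named fact (review of p438873: the datum forms of Cor 3.7 / 3.8 are the EXISTING named facts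
`BelyiModel.Cor_3_7″` / `BelyiModel.Cor_3_8` at `M.toBelyiModel`).  This companion of
`BelyiCuspidalizationDatum.lean` records, by `Iff.rfl`, what those facts SAY in datum terms — the NF-opens
are the datum open immersions `(U, ι, ψ)`, the compared cuspidalization is `ψ : Π_U ↠ Π`, the cusps are the
model's cusps of `U` — and that the datum Cor 3.7 implies the recorded `BelyiModel.Cor_3_7` (p407799) of the
induced model.  abc-iut-L4-t6 (row «COR37-DATUM-RETYPE», abc-iut-L4-lead RULING #8c); typed ≠ proved;
nothing here bears on [IUTchIII] Cor 3.12.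
-/

namespace Literature.AnabelianGeometry.AbsoluteAnabelian.AbsTopII.BelyiDatumModel

open AbsTopI (ConstructionDataClass)

universe u

variable {𝒟 : ConstructionDataClass.{u}} (M : BelyiDatumModel 𝒟)

/-- **Cor 3.7 over the datum, spelled out** — `M.toBelyiModel.Cor_3_7″` unfolds (`Iff.rfl`) to: under
"`𝒟` chain-full, rel-isom-DGC" and the standing hypotheses on the member `X`, for every DATUM NF-open
`O = (U, ι, ψ)` of `X`, some `BelyiCuspidalization` of `Π ↠ G` is isomorphic over `Π` to `ψ : Π_U ↠ Π` (b),
its removed-point decomposition groups are the images of the cusps of `U` (c), and it realizes a genuine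
`Π`-chain whose last `m` •'s compute its `Π_U ↠ Π_V` (a). [cite: MochizukiAbsTopII2013, Cor 3.7 pp.72-73] -/
theorem cor_3_7''_toBelyiModel_iff :
    M.toBelyiModel.Cor_3_7'' ↔
      (𝒟.IsChainFull → 𝒟.RelIsomDGC →
        ∀ (b : 𝒟.Base) (X : (𝒟.datum b).Obj) (h : M.toBelyiModel.IsCor37Member b X) (O : M.NFOpen b X),
          ∃ B : BelyiCuspidalization ((𝒟.datum b).ext X),
            B.cusp.IsoOver O.cuspidalization ∧
              B.cusp.decompositionImages B.cusps =
                O.cuspidalization.decompositionImages (M.cusps b O.U) ∧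
              B.RealizesChain' (M.cusps b X) h.arith_slim h.geom_slim h.geom_ne_bot) :=
  Iff.rfl

/-- **Cor 3.8 over the datum, spelled out** — `M.toBelyiModel.Cor_3_8` unfolds (`Iff.rfl`) to the
bi-anabelian form with BOTH `U_{Xᵢ}` ranging over DATUM NF-opens and compatibility with the representatives
`ψᵢ : Π_{Uᵢ} ↠ Πᵢ`. [cite: MochizukiAbsTopII2013, Cor 3.8 p.74] -/
theorem cor_3_8_toBelyiModel_iff :
    M.toBelyiModel.Cor_3_8 ↔
      (𝒟.IsChainFull → 𝒟.RelIsomDGC →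
        ∀ (b₁ b₂ : 𝒟.Base) (X₁ : (𝒟.datum b₁).Obj) (X₂ : (𝒟.datum b₂).Obj),
          M.toBelyiModel.IsCor37Member b₁ X₁ → M.toBelyiModel.IsCor37Member b₂ X₂ →
          (∃ (l : ℕ) (_ : Fact l.Prime), IsOpen (Set.range (AbsTopIII.cyclotomicChar (𝒟.fld b₁) l)) ∧
            IsOpen (Set.range (AbsTopIII.cyclotomicChar (𝒟.fld b₂) l))) →
          ∀ φ : ((𝒟.datum b₁).ext X₁).arith ≃ₜ* ((𝒟.datum b₂).ext X₂).arith,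
            ((𝒟.datum b₁).ext X₁).geom.map φ.toMonoidHom = ((𝒟.datum b₂).ext X₂).geom →
            ∀ O₁ : M.NFOpen b₁ X₁, ∃ O₂ : M.NFOpen b₂ X₂,
              (∃ φU : O₁.cuspidalization.ext.arith ≃ₜ* O₂.cuspidalization.ext.arith,
                  ∀ x, O₂.cuspidalization.hom.arith (φU x) = φ (O₁.cuspidalization.hom.arith x)) ∧
              ∀ φU φU' : O₁.cuspidalization.ext.arith ≃ₜ* O₂.cuspidalization.ext.arith,
                (∀ x, O₂.cuspidalization.hom.arith (φU x) = φ (O₁.cuspidalization.hom.arith x)) →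
                (∀ x, O₂.cuspidalization.hom.arith (φU' x) = φ (O₁.cuspidalization.hom.arith x)) →
                  ∃ g : O₂.cuspidalization.ext.arith, O₂.cuspidalization.hom.arith g = 1 ∧
                    ∀ x, φU' x = g * φU x * g⁻¹) :=
  Iff.rfl

/-- The datum Cor 3.7 (`Cor_3_7″` of the induced model) implies the recorded `BelyiModel.Cor_3_7` (p407799)
of the induced model. [cite: MochizukiAbsTopII2013, Cor 3.7 pp.72-73] -/
theorem cor_3_7_toBelyiModel_of_cor_3_7'' (h : M.toBelyiModel.Cor_3_7'') : M.toBelyiModel.Cor_3_7 :=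
  BelyiModel.cor_3_7_of_cor_3_7'' h

end Literature.AnabelianGeometry.AbsoluteAnabelian.AbsTopII.BelyiDatumModel
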